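import Mathlib
import Summits.NavierStokesRegularity.OSWSelfSimilar.SheetNSLineTorusCascadeCellEnvelope
import HarnessLib

/-!
# Viscous CLM on the torus (`a = 0`, `σ = 2`): the REFLECTIVE CELL-CHAIN CHECKER — a fixed-point evaluator of the two-sided
# Duhamel cell chain, run BY THE KERNEL (`decide`), and its soundness for one cell

HONEST FRAMING (cell ns-blowup GROUP B «PROFILE SEARCH», zone Z3, row Z3-U addendum A-F2 of `HOME/profile/z3/CENSUS-Z3.md`;
human rulings D-0035/D-0074; Z3-TWIN lineage, eng-5 g13 — «third discretisation»): **1-D MODEL (viscous Constantin–Lax–Majda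
equation `ω_t = ω Hω + ν ω_xx` on `𝕋`); natural-number arithmetic + ODE comparison, kernel-checked; not Euler, not Navier–Stokes;
«violates: none — MODEL». No script: the arithmetic below is evaluated by the Lean kernel.**

THE SCHEME. Fix a precision `D = 2^P`, a datum `c₀ ∈ ℕ` (we run the cascade `IsSineCascade 1 c₀ e`, i.e. the universal family
rescaled by `c₀^k`, so that all modes are `O(1…10³)`), and time cells of length `δ = log(2^j/a)` (`0 < a < 2^j`), on which mode `1`
decays by the EXACT factor `q = a/2^j` and mode `k` by `q^{k²}`. All envelope values are naturals `n` meaning `n/D`, lower values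
rounded DOWN and upper values rounded UP. One cell (`cellLoop`), for `k = 2, 3, …, K` in turn, with the in-cell envelopes
`m_a ≤ e_a(s) ≤ M_a` of the modes `a < k` already in hand (lists `mF`/`MF` and their reverses `mR`/`MR`):
`φk = ⌊(Σ_{a+b=k} m_a m_b)/(2Dk²)⌋`, `Φk = ⌈(Σ M_a M_b)/(2Dk²)⌉` (the quasi-static values), `ρ = ⌊D q^{k²}⌋`,
`nlo = ⌊(φk (D − (ρ+1)) + ℓ ρ)/D⌋` (`stepLo`), `nup = ⌈(Φk (D − ρ) + u (ρ+1))/D⌉` (`stepUp`) (cell-end values, `cell_lb_readout` / `cell_ub_readout` of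
`SheetNSLineTorusCascadeCellEnvelope`), in-cell envelopes `min ℓ nlo`, `max u nup`. A segment (`runSeg`) iterates cells with the
same `q`, keeping running maxima of the in-cell upper envelopes (`usup`, all cells) and running minima of the in-cell lower envelopes
over the WINDOW cells `w₁ ≤ idx < w₂` (`linf`); `runAll` chains segments; `rayLoop` closes with the ray `[t_end, ∞)` (`max u Φk`).

THIS FILE: the definitions (pure structural recursion on `ℕ`/`List ℕ`, kernel-reducible; `Nat` bit shifts, `pow`, `div` are
GMP-accelerated in the kernel) and the list ↔ antidiagonal-sum dictionary (`dot_reverse_eq_sum`). Soundness: one cell in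
`SheetNSLineTorusCascadeCellCheckerSound` (`cellLoop_sound`), segments / run / ray and the user-facing theorem in
`SheetNSLineTorusCascadeCellCheckerRun`.
bears_on: LADDER-NS N5 / zone Z3 (row Z3-U) → N1 linear core. WHAT THIS IS NOT: not NS; no number certified by THIS file.
-/

namespace Summit.NavierStokesRegularity.OSWSelfSimilar
namespace SheetNSLineTorusCascade
namespace CellChain

open Finset Real Set

/-! ### The checker (computable, kernel-reducible) -/

/-- Ceiling division of naturals, `⌈a / b⌉` (for `b > 0`). [folklore] -/
def cdiv (a b : ℕ) : ℕ := (a + b - 1) / b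

/-- `dot xs ys = Σ_i xs[i]·ys[i]` over the common prefix. [folklore] -/
def dot : List ℕ → List ℕ → ℕ
  | x :: xs, y :: ys => x * y + dot xs ys
  | _, _ => 0

/-- Decay brackets `⌊D·q^{k²}⌋` (`q = a/2^j`, `D = 2^P`) for the modes `k, k+1, …` (`n` of them). [new here — MODEL] -/
def rhos (P a j : ℕ) : ℕ → ℕ → List ℕ
  | 0, _ => []
  | n + 1, k => ((a ^ (k * k)) <<< P) >>> (j * k * k) :: rhos P a j n (k + 1)

/-- Lower cell-end value of one mode: `⌊(⌊s/(2Dk²)⌋·(D − (ρ+1)) + ℓ·ρ)/D⌋` (`s` = the lower convolution sum, `ℓ` = the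
lower start value, `ρ = ⌊D q^{k²}⌋`). [new here — MODEL] -/
def stepLo (D k s ℓ ρ : ℕ) : ℕ := (s / (2 * D * k * k) * (D - (ρ + 1)) + ℓ * ρ) / D

/-- Upper cell-end value of one mode: `⌈(⌈S/(2Dk²)⌉·(D − ρ) + u·(ρ+1))/D⌉`. [new here — MODEL] -/
def stepUp (D k S u ρ : ℕ) : ℕ := cdiv (cdiv S (2 * D * k * k) * (D - ρ) + u * (ρ + 1)) D

/-- **One cell**, modes `k, k+1, …` (one per entry of the input lists `lo`, `up`, `rho`): see the module docstring. `mF`/`MF` are the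
in-cell lower/upper envelopes of the modes `1 … k−1` (in this order) and `mR`/`MR` their reverses. Returns
`(newlo, newup, mins, maxs)`. [new here — MODEL] -/
def cellLoop (D : ℕ) : List ℕ → List ℕ → List ℕ → ℕ →
    List ℕ → List ℕ → List ℕ → List ℕ → List ℕ × List ℕ × List ℕ × List ℕ
  | ℓ :: los, u :: ups, ρ :: rhs, k, mF, mR, MF, MR =>
      let nlo := stepLo D k (dot mF mR) ℓ ρ
      let nup := stepUp D k (dot MF MR) u ρ
      let m := min ℓ nlo
      let M := max u nup
      let r := cellLoop D los ups rhs (k + 1) (mF ++ [m]) (m :: mR) (MF ++ [M]) (M :: MR)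
      (nlo :: r.1, nup :: r.2.1, m :: r.2.2.1, M :: r.2.2.2)
  | _, _, _, _, _, _, _, _ => ([], [], [], [])

/-- Pointwise maximum of two lists (common prefix). [folklore] -/
def zipMax : List ℕ → List ℕ → List ℕ
  | x :: xs, y :: ys => max x y :: zipMax xs ys
  | _, _ => []

/-- Pointwise minimum of two lists (common prefix). [folklore] -/
def zipMin : List ℕ → List ℕ → List ℕ
  | x :: xs, y :: ys => min x y :: zipMin xs ys
  | _, _ => []

/-- Checker state at a grid time: mode-`1` bracket `xlo ≤ D c₀ e^{−t} ≤ xhi`, grid values `lo`/`up` of the modes `2…K`, the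
running suprema `usup` (all cells so far) and window infima `linf` of the in-cell envelopes, and the cell counter. [new here — MODEL] -/
structure St where
  /-- lower bound of `D·c₀e^{−t}` -/
  xlo : ℕ
  /-- upper bound of `D·c₀e^{−t}` -/
  xhi : ℕ
  /-- lower grid values of the modes `2…K` (scaled by `D`) -/
  lo : List ℕ
  /-- upper grid values of the modes `2…K` -/
  up : List ℕ
  /-- running maxima of the in-cell upper envelopes, modes `2…K` -/
  usup : List ℕ
  /-- running minima of the in-cell lower envelopes over the window cells, modes `2…K` -/
  linf : List ℕ
  /-- number of cells processed -/
  idx : ℕ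

/-- **One segment**: `n` cells of length `log(2^j/a)`; window cells are `w₁ ≤ idx < w₂`. [new here — MODEL] -/
def runSeg (D a j w₁ w₂ : ℕ) (rho : List ℕ) : ℕ → St → St
  | 0, st => st
  | n + 1, st =>
      let xlo' := (st.xlo * a) >>> j
      let xhi' := cdiv (st.xhi * a) (2 ^ j)
      let r := cellLoop D st.lo st.up rho 2 [xlo'] [xlo'] [st.xhi] [st.xhi]
      runSeg D a j w₁ w₂ rho n
        { xlo := xlo', xhi := xhi', lo := r.1, up := r.2.1,
          usup := zipMax st.usup r.2.2.2,
          linf := if w₁ ≤ st.idx ∧ st.idx < w₂ then zipMin st.linf r.2.2.1 else st.linf,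
          idx := st.idx + 1 }

/-- **The ray** `[t_end, ∞)`: in-cell upper envelopes `max u ⌈Σ M_aM_b/(2Dk²)⌉` of the modes `k, k+1, …` (`ray_ub_readout`).
[new here — MODEL] -/
def rayLoop (D : ℕ) : List ℕ → ℕ → List ℕ → List ℕ → List ℕ
  | u :: ups, k, MF, MR =>
      let M := max u (cdiv (dot MF MR) (2 * D * k * k))
      M :: rayLoop D ups (k + 1) (MF ++ [M]) (M :: MR)
  | [], _, _, _ => []

/-- The list `[0, …, 0]` of length `n`. [folklore] -/
def zeros : ℕ → List ℕ
  | 0 => []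
  | n + 1 => 0 :: zeros n

/-- The list `[B, …, B]` of length `n`. [folklore] -/
def consts (B : ℕ) : ℕ → List ℕ
  | 0 => []
  | n + 1 => B :: consts B n

/-- A segment descriptor: cells of length `log(2^j / a)`, `n` of them. [new here — MODEL] -/
structure Seg where
  /-- numerator of `q = a/2^j` -/
  a : ℕ
  /-- dyadic exponent of `q` -/
  j : ℕ
  /-- number of cells -/
  n : ℕ

/-- **All segments** in order (`K − 1` modes `2…K`). [new here — MODEL] -/
def runAll (P K w₁ w₂ : ℕ) : List Seg → St → St
  | [], st => st
  | sg :: segs, st =>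
      runAll P K w₁ w₂ segs (runSeg (2 ^ P) sg.a sg.j w₁ w₂ (rhos P sg.a sg.j (K - 1) 2) sg.n st)

/-- Initial state at `t = 0`: `e_1(0) = c₀`, `e_k(0) = 0` (`k ≥ 2`); `linf` starts at the ceiling `B`. [new here — MODEL] -/
def init (P K c₀ B : ℕ) : St :=
  { xlo := c₀ * 2 ^ P, xhi := c₀ * 2 ^ P, lo := zeros (K - 1), up := zeros (K - 1),
    usup := zeros (K - 1), linf := consts B (K - 1), idx := 0 }

/-- **The certificate run**: final state and the ray envelopes; returns `(usup, linf)` for the modes `2…K`. [new here — MODEL] -/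
def run (P K c₀ B w₁ w₂ : ℕ) (segs : List Seg) : List ℕ × List ℕ :=
  let st := runAll P K w₁ w₂ segs (init P K c₀ B)
  (zipMax st.usup (rayLoop (2 ^ P) st.up 2 [st.xhi] [st.xhi]), st.linf)

/-! ### Dictionary: lists as mode tables -/

/-- Mode table of an in-cell list: `lget L a = L[a−1]` for `1 ≤ a ≤ |L|`, and `0` for `a = 0` or `a > |L|`. [new here — MODEL] -/
def lget (L : List ℕ) (a : ℕ) : ℕ := if a = 0 then 0 else L.getD (a - 1) 0

/-- Mode `0` reads `0`. [folklore] -/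
theorem lget_zero (L : List ℕ) : lget L 0 = 0 := by simp [lget]

/-- Mode `i+1` reads entry `i`. [folklore] -/
theorem lget_succ (L : List ℕ) (i : ℕ) : lget L (i + 1) = L.getD i 0 := by simp [lget]

/-- Modes beyond the table read `0`. [folklore] -/
theorem lget_of_length_lt (L : List ℕ) {a : ℕ} (ha : L.length < a) : lget L a = 0 := by
  unfold lget
  split_ifs with h
  · rfl
  · exact List.getD_eq_default _ _ (by omega)

/-- Appending a mode does not change the earlier ones. [folklore] -/
theorem lget_append_left (L : List ℕ) (m : ℕ) {a : ℕ} (ha : a ≤ L.length) : lget (L ++ [m]) a = lget L a := by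
  unfold lget
  split_ifs with h
  · rfl
  · rw [List.getD_append _ _ _ _ (by omega)]

/-- The appended mode. [folklore] -/
theorem lget_append_length_succ (L : List ℕ) (m : ℕ) : lget (L ++ [m]) (L.length + 1) = m := by
  rw [lget_succ, List.getD_append_right _ _ _ _ le_rfl]
  simp

/-- `dot` is the sum of products over the common prefix. [folklore] -/
theorem dot_eq_sum (xs ys : List ℕ) (h : xs.length = ys.length) :
    dot xs ys = ∑ i ∈ range xs.length, xs.getD i 0 * ys.getD i 0 := by
  induction xs generalizing ys with
  | nil => simp [dot]
  | cons x xs ih =>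
    cases ys with
    | nil => simp at h
    | cons y ys =>
      simp only [List.length_cons] at h
      rw [dot, List.length_cons, sum_range_succ', ih ys (by omega)]
      simp [add_comm]

/-- **The antidiagonal dictionary.** For an in-cell list `L` of the modes `1…n`:
`dot L L.reverse = Σ_{a ∈ range (n+2)} lget L a · lget L (n+1−a)` — the convolution driving mode `n+1`. [folklore] -/
theorem dot_reverse_eq_sum (L : List ℕ) :
    dot L L.reverse = ∑ a ∈ range (L.length + 2), lget L a * lget L (L.length + 1 - a) := by
  rw [dot_eq_sum L L.reverse (by simp), sum_range_succ, sum_range_succ']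
  have hlast : lget L (L.length + 1) * lget L (L.length + 1 - (L.length + 1)) = 0 := by
    rw [Nat.sub_self, lget_zero, mul_zero]
  have hfirst : lget L 0 * lget L (L.length + 1 - 0) = 0 := by rw [lget_zero, zero_mul]
  rw [hlast, hfirst, add_zero, add_zero]
  refine sum_congr rfl fun i hi => ?_
  have hi' : i < L.length := mem_range.mp hi
  rw [lget_succ, show L.length + 1 - (i + 1) = (L.length - 1 - i) + 1 by omega, lget_succ,
    List.getD_eq_getElem L.reverse 0 (by simpa using hi'), List.getD_eq_getElem L 0 hi',
    List.getD_eq_getElem L 0 (by omega), List.getElem_reverse]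

end CellChain
end SheetNSLineTorusCascade
end Summit.NavierStokesRegularity.OSWSelfSimilar
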